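/-
Copyright (c) 2026. All rights reserved.
Released under Apache 2.0 license as described in the file LICENSE.
-/
import Literature.AlgebraicGeometry.ComplexMultiplication.HyperellipticJacobianEndomorphismAlgebras
import Literature.AlgebraicGeometry.ComplexMultiplication.EndAlgebraPowerMatrix
import Literature.AlgebraicGeometry.Milne1999.LefschetzCentraliserBiproducts
import HarnessLib

/-!
# GGL 2024 Thm. 3.0 at a level `2n`, `n` odd: `J_{2n} ∼ J_n × J_n` and
# `End⁰(J_{2n}) ≅ Mat₂(∏_{d ∣ n, d ≠ 1} ℚ(ζ_d)) ≅ ∏_{d ∣ n, d ≠ 1} Mat₂(ℚ(ζ_d))`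

Layer `Literature/AlgebraicGeometry/ComplexMultiplication`, namespace `…ComplexMultiplication.HyperellipticJacobian`; the sequel of
`HyperellipticJacobianEndomorphismAlgebras` (GGL Lemma 14; Thm. 3.0's last statement at odd levels as orthogonality;
`End⁰(⨁_i A_i) ≅ ∏_i ℚ(ζ_{d_i})` for odd `m`) and of `HyperellipticJacobianTwiceOddLevel` (Thm. 3.0 (4): every realisation of
`Φ_{2d}` is isogenous to every realisation of `Φ_d`, `d` odd).  THEOREMS ONLY (no definition, no named fact, no `sorry`, no
instance).

## The print

A. Gallese, H. Goodson, D. Lombardo, *Monodromy groups and exceptional Hodge classes, I: Fermat Jacobians*, arXiv:2405.20394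
[GalleseGoodsonLombardo2024] (held `paper:arxiv-2405.20394`, p0012–p0015, p0019 read first-hand).  §3 THM. 3.0: «`J_m ∼ ∏_{d ∣ m,
d ≠ 1, 2} X_d` … (4) if `d = 4k+2`, then … `X_d` is isogenous to `X_{d/2}`»; §3.2 (proof of (4)): «`β` provides an isomorphism
between `X_m` and `X_{m/2}` defined over `ℚ`»; §4.2 EXAMPLE 26: «the first two relations are justified by the isogeny `J_{10} ∼ J_5²`
defined over `ℚ`»; §3.5, the sentence after LEMMA 14: «this lemma, combined with the last statement in Thm. 3.0, yields the
geometric endomorphism algebra of `J_m` for every `m`».  For `m = 2n` with `n` ODD the divisors `d ∣ 2n`, `d ∉ {1, 2}`, are the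
`d ∣ n`, `d ≠ 1`, and their doubles `2d`, and `X_{2d} ∼ X_d`; so `J_{2n} ∼ ∏_{d ∣ n, d ≠ 1} X_d² ∼ J_n × J_n` and, the `X_d` (`d` odd)
being simple, pairwise non-isogenous, with `End⁰(X_d) = ℚ(ζ_d)`, `End⁰(J_{2n}) ≅ ∏_{d ∣ n, d ≠ 1} Mat₂(ℚ(ζ_d))` (Mumford §19 Cor. 2
«`End⁰(X) = ⊕ M_{n_i}(D_i)`»; Shimura §5.1 Prop. 3 (proof)).

## The carrier (as in `HyperellipticJacobianExceptionalClasses` §4 and `HyperellipticJacobianEndomorphismAlgebras` §5)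

An odd `M`; distinct levels `d_i ∣ M`, `d_i > 1`, indexed by `Fin (k+1)`; `K_i = ℚ(ζ_{d_i})` with its lower-half type `Φ_i`
(`σ ∈ Φ_i ⟺ 2⟨e(σ)⟩ < d_i`, the CM data of `X_{d_i}`, GGL Lemma 11) realised by `(A_i, ι_i, θ_i)`; `L_i = ℚ(ζ_{2d_i})` with its
lower-half type `Ψ_i` (the CM data of `X_{2d_i}`) realised by `(A'_i, ι'_i, θ'_i)`.  The old part `J_n ↪ J_{2n}` is `⨁_i A_i`, the new
part is `⨁_i A'_i`, and `J_{2n}` is read as `⨁_{Fin 2} (⨁_i A_i, ⨁_i A'_i)` resp. in isotypic shape `⨁_i ⨁_{Fin 2} (A_i, A'_i)`.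

## What is proved

* §1 (plumbing, complex abelian varieties, index `Fin (k+1)`): `isIsogenous_biproduct_of_forall` (componentwise isogenous ⟹
  biproducts isogenous — tree `isIsogeny_biproduct_map`), `isIsogenous_biproduct_pair` (`⨁_{Fin 2}(A, A′) ∼ ⨁_{Fin 2}(A, A)` for
  `A′ ∼ A`), `nonempty_matrix_algEquiv_endAlgebra_biproduct_const` (`Mat_m(End⁰ B) ≃ₐ[ℚ] End⁰(⨁_{Fin m} B)`, the tree's
  `blockAct_id_bijective` as an `AlgEquiv`), **`nonempty_algEquiv_endAlgebra_biproduct_biproduct_pi_matrix`** — for an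
  ORTHOGONAL family `B_i` (any field): `End⁰(⨁_i ⨁_{Fin m} B_i) ≃ₐ[ℚ] ∏_i Mat_m(End⁰ B_i)` (Mumford §19 Cor. 2 as an algebra
  isomorphism; the tree had the dimension and commutativity forms, `CMProductEnd.finrank_endAlgebra_biproduct_powers`).
* §2 **`isIsogenous_biproduct_twiceOdd`** — the new part is isogenous to the old: `⨁_i A'_i ∼ ⨁_i A_i` (Thm. 3.0 (4) summed over
  `d ∣ n`); **`isIsogenous_pair_biproduct_twiceOdd`** — «`J_{2n} ∼ J_n²`»: `⨁_{Fin 2}(⨁_i A_i, ⨁_i A'_i) ∼ ⨁_{Fin 2}(⨁_i A_i, ⨁_i A_i)`;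
  `isIsogenous_biproduct_pairs_twiceOdd` (isotypic shape `⨁_i ⨁_{Fin 2}(A_i, A'_i) ∼ ⨁_i ⨁_{Fin 2} A_i`).
* §3 **`nonempty_endAlgebra_algEquiv_matrix_pi_twiceOdd`** — «the geometric endomorphism algebra of `J_m`», `m = 2n`:
  `End⁰(⨁_{Fin 2}(⨁_i A_i, ⨁_i A'_i)) ≃ₐ[ℚ] Mat₂(∏_i ℚ(ζ_{d_i}))`; **`nonempty_endAlgebra_algEquiv_pi_matrix_twiceOdd`** (isotypic
  shape: `≃ₐ[ℚ] ∏_i Mat₂(ℚ(ζ_{d_i}))`); `finrank_endAlgebra_pair_biproduct_twiceOdd` (`dim_ℚ End⁰ = 4 Σ_i φ(d_i)`, `2·dim = 2 Σ_i φ(d_i)`, NOT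
  commutative); `finrank_endAlgebra_pair_biproduct_twiceOdd_eq_of_levels` — with ALL divisors `d ≠ 1` of `M` present:
  `dim_ℚ End⁰(J_{2M}) = 4(M − 1)`, `dim J_{2M} = M − 1 = g(C_{2M})`.

## Honest column ∕ NOT here

The curve, the involution `β` and «defined over `ℚ`»; the identification of the tree's biproducts with `J_{2n}` itself (the
statements are about the CM data of the factors; every `B` isogenous to them is covered); `End⁰(J_m)` for `4 ∣ m` (needs the
pairwise non-isogeny of the `Y_d` and of `X_d`, `Y_{d′}` across levels, not typed); the ring isomorphism
`Mat₂(∏_i K_i) ≅ ∏_i Mat₂(K_i)` between the two shapes is not spelled out.  `HC_CM` is not touched.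

## References

* [GalleseGoodsonLombardo2024] A. Gallese, H. Goodson, D. Lombardo, arXiv:2405.20394 — §3 Thm. 3.0 (4), §3.2 (proof of (4)), §3.5 Lemma 14
  and the sentence following it, §4.2 Example 26 («`J_{10} ∼ J_5²`»).
* [MumfordAV1970] D. Mumford, *Abelian Varieties* (1970) — §19 Thm. 3 Cor. 1–2 and p. 174.
* [Shimura1998] G. Shimura — §5.1 Prop. 3 (proof) and Prop. 6.
* [Milne1986AbelianVarieties] J. S. Milne, *Abelian Varieties* (Cornell–Silverman 1986) — §12 Prop. 12.1.

## Provenance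

Cell `pub-hodgecm2` (COR-CM), KEPT Literature lane `lit-deligne-3` gen 51 (claim GGL24-TWICE-ODD-JACOBIAN; count-neutral, own lane).
-/

noncomputable section

open CategoryTheory CategoryTheory.Limits NumberField Module

namespace Literature.AlgebraicGeometry.ComplexMultiplication

open Literature.AlgebraicGeometry.Motives
open Literature.AlgebraicGeometry.HodgeTheory (complexBetti)
open Literature.NumberTheory.ComplexMultiplication
open Literature.AlgebraicGeometry.Milne1999 (isIsogeny_biproduct_map)
open Literature.AlgebraicGeometry.ComplexMultiplication.AndreRiemann (blockAct)
open Literature.AlgebraicGeometry.ComplexMultiplication.EndAlgebraPower (blockAct_id_bijective)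

namespace HyperellipticJacobian

/-! ## §1 Plumbing: biproducts of isogenies, `Mat_m(End⁰ B) ≅ End⁰(B^m)`, `End⁰` of a biproduct of powers of an orthogonal family -/

section Plumbing

variable {k : ℕ}

/-- **Componentwise isogenous families have isogenous biproducts** (`⊕ gᵢ` is an isogeny, Mumford §19; tree
`isIsogeny_biproduct_map`). [cite: MumfordAV1970, §19 (p. 174)] [cite: Milne1986AbelianVarieties, §12 Prop. 12.1] -/
theorem isIsogenous_biproduct_of_forall {C D : Fin (k + 1) → AbelianVariety ℂ}
    (h : ∀ i, AbelianVariety.IsIsogenous (C i) (D i)) : AbelianVariety.IsIsogenous (⨁ C) (⨁ D) := by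
  choose g hg using h
  exact ⟨biproduct.map g, isIsogeny_biproduct_map hg⟩

/-- **`A ⊕ A′ ∼ A ⊕ A` for `A′ ∼ A`** (biproducts over `Fin 2`; the isogeny `𝟙 ⊕ u`). [cite: MumfordAV1970, §19 (p. 174)] -/
theorem isIsogenous_biproduct_pair {A A' : AbelianVariety ℂ} (h : AbelianVariety.IsIsogenous A' A) :
    AbelianVariety.IsIsogenous (⨁ fun j : Fin 2 => (![A, A'] : Fin 2 → AbelianVariety ℂ) j) (⨁ fun _ : Fin 2 => A) := by
  obtain ⟨u, hu⟩ := h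
  let g : ∀ j : Fin 2, (![A, A'] : Fin 2 → AbelianVariety ℂ) j ⟶ (fun _ : Fin 2 => A) j :=
    fun j => match j with
      | ⟨0, _⟩ => 𝟙 A
      | ⟨1, _⟩ => u
  have hg : ∀ j, AbelianVariety.IsIsogeny (g j) := fun j => match j with
      | ⟨0, _⟩ => AbelianVariety.isIsogeny_id A
      | ⟨1, _⟩ => hu
  exact ⟨biproduct.map g, isIsogeny_biproduct_map hg⟩

/-- **`Mat_m(End⁰ B) ≃ₐ[ℚ] End⁰(⨁_{Fin m} B)`** — the block-matrix ring isomorphism of the tree (`blockAct_id_bijective`) as a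
`ℚ`-algebra isomorphism («`End_ℚ(B × ⋯ × B)` is identified with the total matrix ring of degree `h` over `End_ℚ(B)`»).
[cite: Shimura1998, §5.1 Prop. 3 (proof)] [cite: MumfordAV1970, §19 (p. 174)] -/
theorem nonempty_matrix_algEquiv_endAlgebra_biproduct_const {K₀ : Type} [Field K₀] (B : AbelianVariety K₀) (m : ℕ) :
    Nonempty (Matrix (Fin m) (Fin m) B.endAlgebra ≃ₐ[ℚ] (⨁ fun _ : Fin m => B).endAlgebra) :=
  ⟨AlgEquiv.ofBijective (blockAct (B := B) (m := m) (RingHom.id B.endAlgebra)).toRatAlgHom blockAct_id_bijective⟩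

/-- **Mumford §19 Cor. 2 as an algebra isomorphism: `End⁰(⨁_i ⨁_{Fin m} B_i) ≃ₐ[ℚ] ∏_i Mat_m(End⁰ B_i)` for an ORTHOGONAL family
`B_i`** (`Hom(B_i, B_j) = 0`, `i ≠ j`) over any field: the powers are again orthogonal (`hom_biproduct_eq_zero`), `End⁰` of an orthogonal
biproduct is the product (`AbelianVariety.nonempty_algEquiv_endAlgebra_biproduct_pi`), and `End⁰(B^m) = Mat_m(End⁰ B)`.
[cite: MumfordAV1970, §19 Cor. 2 of Thm. 3 and p. 174 («End⁰(X) = ⊕ M_{nᵢ}(Dᵢ)»)] [cite: Shimura1998, §5.1 Prop. 3 (proof)] -/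
theorem nonempty_algEquiv_endAlgebra_biproduct_biproduct_pi_matrix {K₀ : Type} [Field K₀] {ι₀ : Type} [Fintype ι₀] [DecidableEq ι₀]
    {B : ι₀ → AbelianVariety K₀} (horth : ∀ i j, i ≠ j → ∀ f : B i ⟶ B j, f = 0) (m : ℕ) :
    Nonempty ((⨁ fun i => ⨁ fun _ : Fin m => B i).endAlgebra ≃ₐ[ℚ] ∀ i, Matrix (Fin m) (Fin m) (B i).endAlgebra) := by
  obtain ⟨e, -⟩ := AbelianVariety.nonempty_algEquiv_endAlgebra_biproduct_pi (A := fun i => ⨁ fun _ : Fin m => B i)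
    (fun i j hij F => AbelianVariety.hom_biproduct_eq_zero (fun _ _ g => horth i j hij g) F)
  have e' : ∀ i, (⨁ fun _ : Fin m => B i).endAlgebra ≃ₐ[ℚ] Matrix (Fin m) (Fin m) (B i).endAlgebra := fun i =>
    (Classical.choice (nonempty_matrix_algEquiv_endAlgebra_biproduct_const (B i) m)).symm
  exact ⟨e.trans (AlgEquiv.piCongrRight e')⟩

end Plumbing

/-! ## §2 `J_{2n} ∼ J_n × J_n` (`n` odd): the new part `⨁_i X_{2d_i}` is isogenous to the old part `⨁_i X_{d_i} ∼ J_n` -/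

section TwiceOddJacobian

open Literature.AlgebraicGeometry.Pohlmann1968 Literature.AlgebraicGeometry.Pohlmann1968.Cyclotomic

variable {k : ℕ} {lev : Fin (k + 1) → ℕ} [∀ i, NeZero (lev i)] [∀ i, NeZero (2 * lev i)]
  {K : Fin (k + 1) → Type} [∀ i, Field (K i)] [∀ i, NumberField (K i)] [∀ i, IsCyclotomicExtension {lev i} ℚ (K i)]
  {L : Fin (k + 1) → Type} [∀ i, Field (L i)] [∀ i, NumberField (L i)] [∀ i, IsCyclotomicExtension {2 * lev i} ℚ (L i)]
  {Φ : ∀ i, CMType (K i)} {Ψ : ∀ i, CMType (L i)}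
  {A A' : Fin (k + 1) → AbelianVariety ℂ} {ι : ∀ i, 𝓞 (K i) →+* End (A i)}
  {θ : ∀ i, K i →+* Module.End ℂ (complexBetti (A i).X 1)} {ι' : ∀ i, 𝓞 (L i) →+* End (A' i)}
  {θ' : ∀ i, L i →+* Module.End ℂ (complexBetti (A' i).X 1)} {M : ℕ} [NeZero M]

omit [∀ i, NeZero (lev i)] [∀ i, NeZero (2 * lev i)] [NeZero M] in
/-- Divisors `d_i > 1` of an odd `M` are odd and at least `3`. [folklore] -/
private theorem odd_and_three_le (hodd : Odd M) (hdvd : ∀ i, lev i ∣ M) (h1 : ∀ i, 1 < lev i) (i : Fin (k + 1)) :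
    Odd (lev i) ∧ 3 ≤ lev i := by
  have ho : Odd (lev i) := hodd.of_dvd_nat (hdvd i)
  refine ⟨ho, ?_⟩
  obtain ⟨r, hr⟩ := ho
  have := h1 i
  omega

omit [NeZero M] in
/-- **GGL THM. 3.0 (4) summed over the divisors of `n`: the NEW part of `J_{2n}` is isogenous to the OLD part** — for realisations
`A'_i` of the lower-half types at the levels `2d_i` and `A_i` at the odd levels `d_i` (`d_i ∣ M`, `M` odd, `d_i > 1`):
`⨁_i A'_i ∼ ⨁_i A_i` (componentwise `X_{2d_i} ∼ X_{d_i}`, tree `isIsogenous_twiceOdd`, and `⊕` of isogenies).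
[cite: GalleseGoodsonLombardo2024, §3 Thm. 3.0 (4) and §3.2 (proof)] [cite: MumfordAV1970, §19 (p. 174)] -/
theorem isIsogenous_biproduct_twiceOdd (hodd : Odd M) (hdvd : ∀ i, lev i ∣ M) (h1 : ∀ i, 1 < lev i)
    (hΦ : ∀ i (σ : K i →+* ℂ), σ ∈ (Φ i).1 ↔ 2 * (expOf (lev i) (K i) σ).val < lev i)
    (hΨ : ∀ i (σ : L i →+* ℂ), σ ∈ (Ψ i).1 ↔ 2 * (expOf (2 * lev i) (L i) σ).val < 2 * lev i)
    (hA : ∀ i, IsCMTypeRealisation (Φ i) (A i) (ι i) (θ i)) (hA' : ∀ i, IsCMTypeRealisation (Ψ i) (A' i) (ι' i) (θ' i)) :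
    AbelianVariety.IsIsogenous (⨁ A') (⨁ A) :=
  isIsogenous_biproduct_of_forall fun i =>
    isIsogenous_twiceOdd (odd_and_three_le hodd hdvd h1 i).1 (odd_and_three_le hodd hdvd h1 i).2 (hΨ i) (hΦ i) (hA' i) (hA i)

omit [NeZero M] in
/-- **«`J_{2n} ∼ J_n²`» (GGL Example 26: «the isogeny `J_{10} ∼ J_5²`»)**: old part ⊕ new part is isogenous to two copies of the old
part — `⨁_{Fin 2}(⨁_i A_i, ⨁_i A'_i) ∼ ⨁_{Fin 2}(⨁_i A_i, ⨁_i A_i)`.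
[cite: GalleseGoodsonLombardo2024, §4.2 Example 26 and §3 Thm. 3.0 (4)] [cite: MumfordAV1970, §19 (p. 174)] -/
theorem isIsogenous_pair_biproduct_twiceOdd (hodd : Odd M) (hdvd : ∀ i, lev i ∣ M) (h1 : ∀ i, 1 < lev i)
    (hΦ : ∀ i (σ : K i →+* ℂ), σ ∈ (Φ i).1 ↔ 2 * (expOf (lev i) (K i) σ).val < lev i)
    (hΨ : ∀ i (σ : L i →+* ℂ), σ ∈ (Ψ i).1 ↔ 2 * (expOf (2 * lev i) (L i) σ).val < 2 * lev i)
    (hA : ∀ i, IsCMTypeRealisation (Φ i) (A i) (ι i) (θ i)) (hA' : ∀ i, IsCMTypeRealisation (Ψ i) (A' i) (ι' i) (θ' i)) :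
    AbelianVariety.IsIsogenous (⨁ fun j : Fin 2 => (![⨁ A, ⨁ A'] : Fin 2 → AbelianVariety ℂ) j)
      (⨁ fun _ : Fin 2 => ⨁ A) :=
  isIsogenous_biproduct_pair (isIsogenous_biproduct_twiceOdd hodd hdvd h1 hΦ hΨ hA hA')

omit [NeZero M] in
/-- **Isotypic shape: `⨁_i (A_i ⊕ A'_i) ∼ ⨁_i (A_i ⊕ A_i)`** (`J_{2n} ∼ ∏_{d ∣ n, d ≠ 1} X_d²`).
[cite: GalleseGoodsonLombardo2024, §3 Thm. 3.0 (4)] [cite: MumfordAV1970, §19 Cor. 1 of Thm. 1 (p. 173)] -/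
theorem isIsogenous_biproduct_pairs_twiceOdd (hodd : Odd M) (hdvd : ∀ i, lev i ∣ M) (h1 : ∀ i, 1 < lev i)
    (hΦ : ∀ i (σ : K i →+* ℂ), σ ∈ (Φ i).1 ↔ 2 * (expOf (lev i) (K i) σ).val < lev i)
    (hΨ : ∀ i (σ : L i →+* ℂ), σ ∈ (Ψ i).1 ↔ 2 * (expOf (2 * lev i) (L i) σ).val < 2 * lev i)
    (hA : ∀ i, IsCMTypeRealisation (Φ i) (A i) (ι i) (θ i)) (hA' : ∀ i, IsCMTypeRealisation (Ψ i) (A' i) (ι' i) (θ' i)) :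
    AbelianVariety.IsIsogenous (⨁ fun i => ⨁ fun j : Fin 2 => (![A i, A' i] : Fin 2 → AbelianVariety ℂ) j)
      (⨁ fun i => ⨁ fun _ : Fin 2 => A i) :=
  isIsogenous_biproduct_of_forall fun i => isIsogenous_biproduct_pair
    (isIsogenous_twiceOdd (odd_and_three_le hodd hdvd h1 i).1 (odd_and_three_le hodd hdvd h1 i).2 (hΨ i) (hΦ i) (hA' i) (hA i))

/-! ## §3 `End⁰(J_{2n}) ≅ Mat₂(∏_i ℚ(ζ_{d_i})) ≅ ∏_i Mat₂(ℚ(ζ_{d_i}))`, of dimension `4 Σ_i φ(d_i) = 4(n − 1)` -/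

/-- **«the geometric endomorphism algebra of `J_m`», `m = 2n`, `n` odd: `End⁰(⨁_{Fin 2}(⨁_i A_i, ⨁_i A'_i)) ≃ₐ[ℚ] Mat₂(∏_i ℚ(ζ_{d_i}))`**
(`J_{2n} ∼ J_n²`, `End⁰` is an isogeny invariant, `End⁰(B²) = Mat₂(End⁰ B)` and `End⁰(J_n) ≅ ∏_i ℚ(ζ_{d_i})`, tree
`nonempty_endAlgebra_biproduct_algEquiv_pi_of_levels`). [cite: GalleseGoodsonLombardo2024, §3.5 Lemma 14 and the sentence following it; §4.2 Example 26]
[cite: MumfordAV1970, §19 Cor. 2 of Thm. 3 and p. 174] [cite: Shimura1998, §5.1 Prop. 3 (proof) and Prop. 6] -/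
theorem nonempty_endAlgebra_algEquiv_matrix_pi_twiceOdd (hodd : Odd M) (hdvd : ∀ i, lev i ∣ M) (hinj : Function.Injective lev)
    (h1 : ∀ i, 1 < lev i) (hΦ : ∀ i (σ : K i →+* ℂ), σ ∈ (Φ i).1 ↔ 2 * (expOf (lev i) (K i) σ).val < lev i)
    (hΨ : ∀ i (σ : L i →+* ℂ), σ ∈ (Ψ i).1 ↔ 2 * (expOf (2 * lev i) (L i) σ).val < 2 * lev i)
    (hA : ∀ i, IsCMTypeRealisation (Φ i) (A i) (ι i) (θ i)) (hA' : ∀ i, IsCMTypeRealisation (Ψ i) (A' i) (ι' i) (θ' i)) :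
    Nonempty ((⨁ fun j : Fin 2 => (![⨁ A, ⨁ A'] : Fin 2 → AbelianVariety ℂ) j).endAlgebra ≃ₐ[ℚ]
      Matrix (Fin 2) (Fin 2) (∀ i, K i)) := by
  obtain ⟨e₁⟩ := (isIsogenous_pair_biproduct_twiceOdd hodd hdvd h1 hΦ hΨ hA hA').nonempty_endAlgebra_algEquiv
  obtain ⟨e₂⟩ := nonempty_matrix_algEquiv_endAlgebra_biproduct_const (⨁ A) 2
  obtain ⟨e₃⟩ := nonempty_endAlgebra_biproduct_algEquiv_pi_of_levels hodd hdvd hinj hΦ hA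
  exact ⟨(e₁.trans e₂.symm).trans e₃.mapMatrix⟩

/-- **Isotypic shape: `End⁰(⨁_i (A_i ⊕ A'_i)) ≃ₐ[ℚ] ∏_i Mat₂(ℚ(ζ_{d_i}))`** — «`End⁰(X) = ⊕ M_{n_i}(D_i)`» with `n_i = 2`,
`D_i = End⁰(X_{d_i}) = ℚ(ζ_{d_i})` (the `X_{d_i}`, `d_i` odd, are pairwise orthogonal, tree `hom_eq_zero_of_levels`).
[cite: GalleseGoodsonLombardo2024, §3.5 Lemma 14 and the sentence following it] [cite: MumfordAV1970, §19 Cor. 2 of Thm. 3 and p. 174] -/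
theorem nonempty_endAlgebra_algEquiv_pi_matrix_twiceOdd (hodd : Odd M) (hdvd : ∀ i, lev i ∣ M) (hinj : Function.Injective lev)
    (h1 : ∀ i, 1 < lev i) (hΦ : ∀ i (σ : K i →+* ℂ), σ ∈ (Φ i).1 ↔ 2 * (expOf (lev i) (K i) σ).val < lev i)
    (hΨ : ∀ i (σ : L i →+* ℂ), σ ∈ (Ψ i).1 ↔ 2 * (expOf (2 * lev i) (L i) σ).val < 2 * lev i)
    (hA : ∀ i, IsCMTypeRealisation (Φ i) (A i) (ι i) (θ i)) (hA' : ∀ i, IsCMTypeRealisation (Ψ i) (A' i) (ι' i) (θ' i)) :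
    Nonempty ((⨁ fun i => ⨁ fun j : Fin 2 => (![A i, A' i] : Fin 2 → AbelianVariety ℂ) j).endAlgebra ≃ₐ[ℚ]
      ∀ i, Matrix (Fin 2) (Fin 2) (K i)) := by
  classical
  obtain ⟨e₁⟩ := (isIsogenous_biproduct_pairs_twiceOdd hodd hdvd h1 hΦ hΨ hA hA').nonempty_endAlgebra_algEquiv
  obtain ⟨e₂⟩ := nonempty_algEquiv_endAlgebra_biproduct_biproduct_pi_matrix (B := A)
    (fun i j hij f => hom_eq_zero_of_levels hodd hdvd hinj hΦ hA hij f) 2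
  have hodd' : ∀ i, Odd (lev i) := fun i => (odd_and_three_le hodd hdvd h1 i).1
  have e₃ : ∀ i, Matrix (Fin 2) (Fin 2) (A i).endAlgebra ≃ₐ[ℚ] Matrix (Fin 2) (Fin 2) (K i) := fun i =>
    (Classical.choice (nonempty_endAlgebra_algEquiv_odd (hodd' i) (Φ i) (hΦ i) (hA i))).mapMatrix
  exact ⟨(e₁.trans e₂).trans (AlgEquiv.piCongrRight e₃)⟩

/-- **`dim_ℚ End⁰(J_{2n}) = 4 Σ_i φ(d_i)`, `2·dim J_{2n} = 2 Σ_i φ(d_i)`, and `End⁰(J_{2n})` is NOT commutative** (on the carrier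
`⨁_{Fin 2}(⨁_i A_i, ⨁_i A'_i)`). [cite: GalleseGoodsonLombardo2024, §3 Thm. 3.0 («dim X_d = φ(d)/2») and §3.5] [cite: MumfordAV1970, §19 Cor. 2 of Thm. 3] -/
theorem finrank_endAlgebra_pair_biproduct_twiceOdd (hodd : Odd M) (hdvd : ∀ i, lev i ∣ M) (hinj : Function.Injective lev)
    (h1 : ∀ i, 1 < lev i) (hΦ : ∀ i (σ : K i →+* ℂ), σ ∈ (Φ i).1 ↔ 2 * (expOf (lev i) (K i) σ).val < lev i)
    (hΨ : ∀ i (σ : L i →+* ℂ), σ ∈ (Ψ i).1 ↔ 2 * (expOf (2 * lev i) (L i) σ).val < 2 * lev i)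
    (hA : ∀ i, IsCMTypeRealisation (Φ i) (A i) (ι i) (θ i)) (hA' : ∀ i, IsCMTypeRealisation (Ψ i) (A' i) (ι' i) (θ' i)) :
    finrank ℚ (⨁ fun j : Fin 2 => (![⨁ A, ⨁ A'] : Fin 2 → AbelianVariety ℂ) j).endAlgebra = 4 * ∑ i, Nat.totient (lev i) ∧
    2 * (⨁ fun j : Fin 2 => (![⨁ A, ⨁ A'] : Fin 2 → AbelianVariety ℂ) j).dim = 2 * ∑ i, Nat.totient (lev i) ∧
    ¬ ∀ u v : (⨁ fun j : Fin 2 => (![⨁ A, ⨁ A'] : Fin 2 → AbelianVariety ℂ) j).endAlgebra, u * v = v * u := by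
  classical
  obtain ⟨e⟩ := nonempty_endAlgebra_algEquiv_matrix_pi_twiceOdd hodd hdvd hinj h1 hΦ hΨ hA hA'
  have hK : ∀ i, finrank ℚ (K i) = Nat.totient (lev i) := fun i =>
    IsCyclotomicExtension.finrank (K := ℚ) (n := lev i) (K i)
      (Polynomial.cyclotomic.irreducible_rat (Nat.pos_of_ne_zero (NeZero.ne (lev i))))
  have hL : ∀ i, finrank ℚ (L i) = Nat.totient (lev i) := fun i => by
    rw [IsCyclotomicExtension.finrank (K := ℚ) (n := 2 * lev i) (L i)
      (Polynomial.cyclotomic.irreducible_rat (Nat.pos_of_ne_zero (NeZero.ne (2 * lev i)))),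
      Nat.totient_mul_of_prime_of_not_dvd Nat.prime_two (odd_and_three_le hodd hdvd h1 i).1.not_two_dvd_nat]
    simp
  refine ⟨?_, ?_, fun hcomm => ?_⟩
  · rw [e.toLinearEquiv.finrank_eq, Module.finrank_matrix, Module.finrank_pi_fintype, Fintype.card_fin]
    refine (congrArg (fun s => 2 * 2 * s) (Finset.sum_congr rfl fun i _ => hK i)).trans ?_
    ring
  · have hdimA : ∀ i, 2 * (A i).dim = Nat.totient (lev i) := fun i => by
      have h1' : (A i).dim = finrank ℚ (K i) / 2 := Motives.schemeDim_eq_holds (hA i).1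
      have h2 := CMTypeLattice.two_mul_card_eq_finrank (Φ i)
      rw [← hK i]; omega
    have hdimA' : ∀ i, 2 * (A' i).dim = Nat.totient (lev i) := fun i => by
      have h1' : (A' i).dim = finrank ℚ (L i) / 2 := Motives.schemeDim_eq_holds (hA' i).1
      have h2 := CMTypeLattice.two_mul_card_eq_finrank (Ψ i)
      rw [← hL i]; omega
    rw [AbelianVariety.dim_biproduct, Fin.sum_univ_two]
    simp only [Matrix.cons_val_zero, Matrix.cons_val_one]
    rw [AbelianVariety.dim_biproduct A, AbelianVariety.dim_biproduct A', mul_add, Finset.mul_sum, Finset.mul_sum,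
      Finset.sum_congr rfl fun i _ => hdimA i, Finset.sum_congr rfl fun i _ => hdimA' i]
    ring
  · -- `Mat₂` of a non-zero ring is not commutative: `E₀₁ E₁₀ ≠ E₁₀ E₀₁`
    have h := hcomm (e.symm (Matrix.single 0 1 1)) (e.symm (Matrix.single 1 0 1))
    rw [← map_mul, ← map_mul, e.symm.injective.eq_iff] at h
    have h00 := congrFun (congrFun h 0) 0
    simp [Matrix.mul_apply, Matrix.single] at h00

/-- **With ALL divisors `d ≠ 1` of the odd `M` as levels: `dim_ℚ End⁰(J_{2M}) = 4(M − 1)` and `dim J_{2M} = M − 1 = g(C_{2M})`**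
(the genus of `y² = x^{2M} + 1`; Gauss `Σ_{d ∣ M} φ(d) = M`). [cite: GalleseGoodsonLombardo2024, §3 Thm. 3.0 and §3.1 («dim J_m = g(m)»)]
[cite: MumfordAV1970, §19 Cor. 2 of Thm. 3] -/
theorem finrank_endAlgebra_pair_biproduct_twiceOdd_eq_of_levels (hodd : Odd M) (hdvd : ∀ i, lev i ∣ M) (hinj : Function.Injective lev)
    (h1 : ∀ i, 1 < lev i) (hsurj : ∀ d, d ∣ M → 1 < d → ∃ i, lev i = d)
    (hΦ : ∀ i (σ : K i →+* ℂ), σ ∈ (Φ i).1 ↔ 2 * (expOf (lev i) (K i) σ).val < lev i)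
    (hΨ : ∀ i (σ : L i →+* ℂ), σ ∈ (Ψ i).1 ↔ 2 * (expOf (2 * lev i) (L i) σ).val < 2 * lev i)
    (hA : ∀ i, IsCMTypeRealisation (Φ i) (A i) (ι i) (θ i)) (hA' : ∀ i, IsCMTypeRealisation (Ψ i) (A' i) (ι' i) (θ' i)) :
    finrank ℚ (⨁ fun j : Fin 2 => (![⨁ A, ⨁ A'] : Fin 2 → AbelianVariety ℂ) j).endAlgebra = 4 * (M - 1) ∧
    (⨁ fun j : Fin 2 => (![⨁ A, ⨁ A'] : Fin 2 → AbelianVariety ℂ) j).dim = M - 1 := by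
  obtain ⟨hfr, hdim, -⟩ := finrank_endAlgebra_pair_biproduct_twiceOdd hodd hdvd hinj h1 hΦ hΨ hA hA'
  obtain ⟨-, hsum⟩ := finrank_endAlgebra_biproduct_eq_sub_one_of_levels hodd hdvd hinj h1 hsurj hΦ hA
  -- `2 · dim(⨁ A) = Σ φ(d_i) = M − 1`
  have hS : ∑ i, Nat.totient (lev i) = M - 1 := by
    have h2 : 2 * (⨁ A).dim = ∑ i, Nat.totient (lev i) := by
      classical
      have hK : ∀ i, finrank ℚ (K i) = Nat.totient (lev i) := fun i =>
        IsCyclotomicExtension.finrank (K := ℚ) (n := lev i) (K i)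
          (Polynomial.cyclotomic.irreducible_rat (Nat.pos_of_ne_zero (NeZero.ne (lev i))))
      have hdimA : ∀ i, 2 * (A i).dim = Nat.totient (lev i) := fun i => by
        have h1' : (A i).dim = finrank ℚ (K i) / 2 := Motives.schemeDim_eq_holds (hA i).1
        have h2 := CMTypeLattice.two_mul_card_eq_finrank (Φ i)
        rw [← hK i]; omega
      rw [AbelianVariety.dim_biproduct A, Finset.mul_sum]
      exact Finset.sum_congr rfl fun i _ => hdimA i
    omega
  rw [hS] at hfr hdim
  exact ⟨hfr, by omega⟩

end TwiceOddJacobian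

end HyperellipticJacobian

end Literature.AlgebraicGeometry.ComplexMultiplication

end
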